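import Mathlib
import HarnessLib
import Summits.HubbardSuperconductivity.HubbardSuperconductivity.Theorems.KLProgrammeKLRegimeEngineV8E5LinesTrivialGram
import Summits.HubbardSuperconductivity.HubbardSuperconductivity.Theorems.KLProgrammeKLRegimeEngineV8E5PointAugment
import Summits.HubbardSuperconductivity.HubbardSuperconductivity.Theorems.KLProgrammeKLRegimeSectorRadialAlignment
import Literature.MathematicalPhysics.QuantumLattice.HubbardShiftedCovarianceDecomposition

/-!
# Route `KLProgramme` — ENGINE child gen 8 (stmt-HubbardSuperconductivity-20437 `KLRegimeEngineV17F2`), SKELETON v2 class #3, (RA-U) SUPPLIER part 2: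
# the carrier's three covariances as SHELL-SUPPORTED NORMAL COVARIANCES and their Gram / entry / row data on the POINT-AUGMENTED fat family
# (cell gate-hubbard-kl, seat p5 g10; pen (R71e); memo RA-U-SUPPLY §5; feeds `…EngineV8E5CarrierBlockStep` §2/§3)

The doors at the carrier geometry (`carrierStep_ordersGe2_lev_le` / `carrierStep_firstOrder_lev_le`, …E5CarrierBlockStep) read a covariance
`normalCovariance L M p` through: the symbol's SUPPORT in a shell `{ρ_K ≤ Λ_{J₁}}`, `IsGramBoundedR` of its pull-back to the point-augmented fat family,
its row/column sums there.  The (RA-U) composition (memo §5; `W_Λ = e^{Δ_{C∞}}V + e^{Δ_D}[effAction C_Λ V − e^{Δ_{C_Λ}}V]`) uses THREE such covariances of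
…EngineV8E5Share: the dressed partial slice `C_Λ = klE5DressedSlice = normalCovariance (s_Λ/(1+s_Λκ))`, the dressed soft line
`D = klE5Total − C_Λ = normalCovariance (klE5SoftLineSym)` (`klE5Total_sub_dressedSlice_eq_normalCovariance`), and the total `C∞ = D + C_Λ`.  This file supplies,
for each, the support (`ρ_K ≤ Λ_{n₀}`) and the soft shape (`A_p = 2`, `8`, `10`) under the dressing smallness, and — generically for any soft-shaped symbol
supported in the plateau — the Gram data on the point-augmented fat family from k3c2-p2's plain-fat package (`gram_softShaped_bgmFat_sharp_klEng`) by the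
transfer lemmas of …E5PointAugment §2:

* §4 `norm_sectorGramF/G_pointAugmentFat_le_of_forall` — Gram half-norm transfer WITHOUT the charge restriction of …E5PointAugment (the half-norms do not
  read the charge);
* §5 `klRadius_le_of_klE5SliceSym_ne_zero`, `klRadius_le_of_klE5DressedSliceSym_ne_zero`, `norm_klE5DressedSliceSym_le_div_radius` (`A_p = 2`),
  `klE5Total_eq_normalCovariance` (`C∞ = normalCovariance (soft + dressed slice)`), `klRadius_le_of_klE5TotalSym_ne_zero`, `norm_klE5TotalSym_le_div_radius` (`A_p = 10`);
* §6 **`gram_softShaped_pointAugmentFat_klEng`** — `∃ Cκ > 0`: under EXACTLY the binders of k3c2-p2's package (doors `klEngC₃3`/`klEngU₀4`/`klEngL₃`/`klEngM₃`,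
  `FrameOK`, fat level `1 ≤ m ≤ nScales β + 1`), for every soft-shaped symbol (`A_p`) supported in `{ρ_K ≤ Λ_{m+1}}` and every choice `e` of point momenta:
  on `pointAugmentFat (klAnisoFamily … m) (bgmFatMultiplier … m) e` the entries are `≤ A_p·Cκ·e₀·8^{−m}`, both Gram half-norms are `≤ √(A_p·Cκ·e₀·8^{−m})`,
  the pulled-back line is `IsGramBoundedR` with that constant, and PLAIN-fat row/column sums `≤ α` transfer unchanged — the `hGB`/`hrow`/`hcol` inputs of the
  carrier doors (the (b) row datum itself stays a hypothesis: (L1)-type, p1 lineage / k3c1).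

Pure composition; no definitions, no named facts, nothing about the model's sizes is asserted; nothing asserts superconductivity.
-/

noncomputable section

namespace Summit.HubbardSuperconductivity.HubbardSuperconductivity.Theorems.KLRegimeSplit

set_option linter.dupNamespace false -- summit = problem name (single-conjunct summit), D-0017

open Real Finset Literature.MathematicalPhysics.QuantumLattice Literature.Probability.LatticeModels GrassmannAlgebra Matrix
open Literature.MathematicalPhysics.QuantumLattice.FermiRG
open Summit.HubbardSuperconductivity.HubbardSuperconductivity.Theorems.KLProgrammeLegKernels
open Summit.HubbardSuperconductivity.HubbardSuperconductivity.Theorems.KLRegimeWick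
open Summit.HubbardSuperconductivity.HubbardSuperconductivity.Theorems.EngineV8
open Summit.HubbardSuperconductivity.HubbardSuperconductivity.Theorems.TwoPointAssembly
open Summit.HubbardSuperconductivity.HubbardSuperconductivity.Theorems.TorusFourierL2
open Summit.HubbardSuperconductivity.HubbardSuperconductivity.Theorems.DispersionFlow

/-! ## §4 Gram half-norm transfer to the point-augmented fat family, all charges -/

section Transfer

variable {L M N q : ℕ} [NeZero L] (β : ℝ) (F Ft : Fin N → FreqMomentum L M → ℂ) (e : Fin q → FreqMomentum L M)

/-- **Gram data transfer, left vectors, every label**: for a symbol supported in the old plateau, `‖sectorGramF … F̃⁺ p Y‖ ≤ κ` for EVERY augmented label `Y`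
from `‖sectorGramF … F̃ p ·‖ ≤ κ` (old legs read the old vector; point legs see a vanishing symbol). [folklore] -/
theorem norm_sectorGramF_pointAugmentFat_le_of_forall (p : FreqMomentum L M × Fin 2 → ℂ) (hp : ∀ ks, p ks ≠ 0 → ∑ ω, F ω ks.1 = 1) {κ : ℝ} (hκ : 0 ≤ κ)
    (h : ∀ Y : SpaceTimeIdx L M × SectorLeg N, ‖sectorGramF L M β Ft p Y‖ ≤ κ) (Y : SpaceTimeIdx L M × SectorLeg (N + q)) :
    ‖sectorGramF L M β (pointAugmentFat F Ft e) p Y‖ ≤ κ := by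
  obtain ⟨ξ, ⟨⟨ω, σ⟩, c⟩⟩ := Y
  induction ω using Fin.addCases with
  | left ω =>
    have he : ‖sectorGramF L M β (pointAugmentFat F Ft e) p (ξ, ((Fin.castAdd q ω, σ), c))‖ = ‖sectorGramF L M β Ft p (ξ, ((ω, σ), c))‖ := by
      refine (pow_left_inj₀ (norm_nonneg _) (norm_nonneg _) two_ne_zero).1 ?_
      rw [norm_sq_sectorGramF, norm_sq_sectorGramF]
      simp only [pointAugmentFat_castAdd]
    rw [he]; exact h _
  | right j =>
    have h0 : ‖sectorGramF L M β (pointAugmentFat F Ft e) p (ξ, ((Fin.natAdd N j, σ), c))‖ ^ 2 = 0 := by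
      rw [norm_sq_sectorGramF]
      refine sum_eq_zero fun k _ => ?_
      by_cases hk : pointAugmentFat F Ft e (Fin.natAdd N j) k = 0
      · simp only [hk, norm_zero, zero_pow two_ne_zero, mul_zero, zero_mul]
      · have hpk : p (k, σ) = 0 := by
          by_contra hne
          exact (pointAugmentFat_natAdd_ne_zero F Ft e hk).2 (hp (k, σ) hne)
        simp only [hpk, norm_zero, mul_zero]
    rw [pow_eq_zero_iff two_ne_zero] at h0
    rw [h0]; exact hκ

/-- **Gram data transfer, right vectors, every label.** [folklore] -/
theorem norm_sectorGramG_pointAugmentFat_le_of_forall (p : FreqMomentum L M × Fin 2 → ℂ) (hp : ∀ ks, p ks ≠ 0 → ∑ ω, F ω ks.1 = 1) {κ : ℝ} (hκ : 0 ≤ κ)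
    (h : ∀ Y' : SpaceTimeIdx L M × SectorLeg N, ‖sectorGramG L M β Ft p Y'‖ ≤ κ) (Y' : SpaceTimeIdx L M × SectorLeg (N + q)) :
    ‖sectorGramG L M β (pointAugmentFat F Ft e) p Y'‖ ≤ κ := by
  obtain ⟨ξ, ⟨⟨ω, σ⟩, c⟩⟩ := Y'
  induction ω using Fin.addCases with
  | left ω =>
    have he : ‖sectorGramG L M β (pointAugmentFat F Ft e) p (ξ, ((Fin.castAdd q ω, σ), c))‖ = ‖sectorGramG L M β Ft p (ξ, ((ω, σ), c))‖ := by
      refine (pow_left_inj₀ (norm_nonneg _) (norm_nonneg _) two_ne_zero).1 ?_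
      rw [norm_sq_sectorGramG, norm_sq_sectorGramG]
      simp only [pointAugmentFat_castAdd]
    rw [he]; exact h _
  | right j =>
    have h0 : ‖sectorGramG L M β (pointAugmentFat F Ft e) p (ξ, ((Fin.natAdd N j, σ), c))‖ ^ 2 = 0 := by
      rw [norm_sq_sectorGramG]
      refine sum_eq_zero fun k _ => ?_
      by_cases hk : pointAugmentFat F Ft e (Fin.natAdd N j) k = 0
      · simp only [hk, norm_zero, zero_pow two_ne_zero, mul_zero, zero_mul]
      · have hpk : p (k, σ) = 0 := by
          by_contra hne
          exact (pointAugmentFat_natAdd_ne_zero F Ft e hk).2 (hp (k, σ) hne)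
        simp only [hpk, norm_zero, mul_zero]
    rw [pow_eq_zero_iff two_ne_zero] at h0
    rw [h0]; exact hκ

end Transfer

/-! ## §5 The carrier's covariances: supports and soft shapes -/

section Symbols

variable {L M : ℕ} (β μ : ℝ) (K : TrigPolyC4v) (n₀ : ℕ) (κ : FreqMomentum L M × Fin 2 → ℂ)

/-- **The partial-slice symbol is supported in the shell `{ρ_K ≤ Λ_{n₀}}`** (`0 < Λ ≤ Λ_{n₀}`): above `Λ_{n₀}` both cutoff weights equal `1`. [folklore] -/
theorem klRadius_le_of_klE5SliceSym_ne_zero {Λ : ℝ} (hΛ : 0 < Λ) (hΛn : Λ ≤ klScale klE0 n₀) (ks : FreqMomentum L M × Fin 2)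
    (h : klE5SliceSym L M β μ K n₀ Λ ks ≠ 0) :
    Real.sqrt (matsubaraFreq β M ks.1.1 ^ 2 + nambuXiCT L μ K ks.1.2 ^ 2) ≤ klScale klE0 n₀ := by
  have hn0 : 0 < klScale klE0 n₀ := by unfold klScale klE0; positivity
  by_contra hgt
  have hgt' : klScale klE0 n₀ < Real.sqrt (matsubaraFreq β M ks.1.1 ^ 2 + nambuXiCT L μ K ks.1.2 ^ 2) := lt_of_not_ge hgt
  have hsq : ∀ Λ' : ℝ, 0 < Λ' → Λ' ≤ klScale klE0 n₀ → Λ' ^ 2 ≤ matsubaraFreq β M ks.1.1 ^ 2 + nambuXiCT L μ K ks.1.2 ^ 2 := by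
    intro Λ' h0 h1
    have h3 : Λ' ^ 2 < Real.sqrt (matsubaraFreq β M ks.1.1 ^ 2 + nambuXiCT L μ K ks.1.2 ^ 2) ^ 2 :=
      pow_lt_pow_left₀ (lt_of_le_of_lt h1 hgt') h0.le two_ne_zero
    rw [Real.sq_sqrt (by positivity)] at h3
    exact h3.le
  have w0 : hubbardCutoffWeightCT L M β μ K (klScale klE0 n₀) ks.1 = 1 := hubbardCutoffWeightCT_eq_one_of_sq_le β μ K hn0 ks.1 (hsq _ hn0 le_rfl)
  have wΛ : hubbardCutoffWeightCT L M β μ K Λ ks.1 = 1 := hubbardCutoffWeightCT_eq_one_of_sq_le β μ K hΛ ks.1 (hsq _ hΛ hΛn)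
  exact h (klE5SliceSym_eq_zero_of_weight_eq L M β μ K n₀ Λ ks (by rw [wΛ, w0]))

/-- **The dressed partial-slice symbol `s_Λ/(1 + s_Λκ)` (the symbol of `klE5DressedSlice`) has the same support.** [folklore] -/
theorem klRadius_le_of_klE5DressedSliceSym_ne_zero {Λ : ℝ} (hΛ : 0 < Λ) (hΛn : Λ ≤ klScale klE0 n₀) (ks : FreqMomentum L M × Fin 2)
    (h : klE5SliceSym L M β μ K n₀ Λ ks / (1 + klE5SliceSym L M β μ K n₀ Λ ks * κ ks) ≠ 0) :
    Real.sqrt (matsubaraFreq β M ks.1.1 ^ 2 + nambuXiCT L μ K ks.1.2 ^ 2) ≤ klScale klE0 n₀ :=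
  klRadius_le_of_klE5SliceSym_ne_zero β μ K n₀ hΛ hΛn ks fun h0 => h (by rw [h0, zero_div])

/-- **The dressed partial slice is soft-shaped with `A_p = 2`**: under the dressing smallness `‖s_Λ(ks)κ(ks)‖ ≤ ½`,
`‖s_Λ/(1 + s_Λκ)‖ ≤ 2·βL²/√(ω² + e_K²)` (`0 ≤ β`). [folklore] -/
theorem norm_klE5DressedSliceSym_le_div_radius (hβ : 0 ≤ β) {Λ : ℝ} (ks : FreqMomentum L M × Fin 2)
    (hsm : ‖klE5SliceSym L M β μ K n₀ Λ ks * κ ks‖ ≤ 1 / 2) :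
    ‖klE5SliceSym L M β μ K n₀ Λ ks / (1 + klE5SliceSym L M β μ K n₀ Λ ks * κ ks)‖ ≤
      2 * (β * (L : ℝ) ^ 2) / Real.sqrt (matsubaraFreq β M ks.1.1 ^ 2 + nambuXiCT L μ K ks.1.2 ^ 2) := by
  have hs := norm_klE5SliceSym_le_div_radius (L := L) (M := M) β μ K n₀ hβ Λ ks
  have hden : 1 / 2 ≤ ‖1 + klE5SliceSym L M β μ K n₀ Λ ks * κ ks‖ := by
    have h1 := norm_sub_norm_le (1 : ℂ) (-(klE5SliceSym L M β μ K n₀ Λ ks * κ ks))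
    rw [norm_one, norm_neg, sub_neg_eq_add] at h1
    linarith
  have hden0 : 0 < ‖1 + klE5SliceSym L M β μ K n₀ Λ ks * κ ks‖ := lt_of_lt_of_le (by norm_num) hden
  rw [norm_div, div_le_iff₀ hden0]
  have h0 : 0 ≤ 2 * (β * (L : ℝ) ^ 2) / Real.sqrt (matsubaraFreq β M ks.1.1 ^ 2 + nambuXiCT L μ K ks.1.2 ^ 2) := by positivity
  calc ‖klE5SliceSym L M β μ K n₀ Λ ks‖ ≤ β * (L : ℝ) ^ 2 / Real.sqrt (matsubaraFreq β M ks.1.1 ^ 2 + nambuXiCT L μ K ks.1.2 ^ 2) := hs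
    _ = 2 * (β * (L : ℝ) ^ 2) / Real.sqrt (matsubaraFreq β M ks.1.1 ^ 2 + nambuXiCT L μ K ks.1.2 ^ 2) * (1 / 2) := by ring
    _ ≤ 2 * (β * (L : ℝ) ^ 2) / Real.sqrt (matsubaraFreq β M ks.1.1 ^ 2 + nambuXiCT L μ K ks.1.2 ^ 2) * ‖1 + klE5SliceSym L M β μ K n₀ Λ ks * κ ks‖ :=
        mul_le_mul_of_nonneg_left hden h0

variable [NeZero L]

/-- **The total covariance of the step is ONE normal covariance**: `klE5Total = normalCovariance (klE5SoftLineSym … Λ + s_Λ/(1+s_Λκ))` for every `Λ`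
(`klE5Total_sub_dressedSlice_eq_normalCovariance` + `normalCovariance_add_symbol`). [folklore] -/
theorem klE5Total_eq_normalCovariance (Λ : ℝ) :
    klE5Total L M β μ K n₀ κ = normalCovariance L M (fun ks => klE5SoftLineSym L M β μ K n₀ κ Λ ks +
      klE5SliceSym L M β μ K n₀ Λ ks / (1 + klE5SliceSym L M β μ K n₀ Λ ks * κ ks)) := by
  rw [normalCovariance_add_symbol, ← klE5Total_sub_dressedSlice_eq_normalCovariance L M β μ K n₀ κ Λ]
  unfold klE5DressedSlice
  abel

omit [NeZero L] in
/-- **The total symbol is supported in the shell `{ρ_K ≤ Λ_{n₀}}`** (`0 < Λ ≤ Λ_{n₀}`). [folklore] -/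
theorem klRadius_le_of_klE5TotalSym_ne_zero {Λ : ℝ} (hΛ : 0 < Λ) (hΛn : Λ ≤ klScale klE0 n₀) (ks : FreqMomentum L M × Fin 2)
    (h : klE5SoftLineSym L M β μ K n₀ κ Λ ks + klE5SliceSym L M β μ K n₀ Λ ks / (1 + klE5SliceSym L M β μ K n₀ Λ ks * κ ks) ≠ 0) :
    Real.sqrt (matsubaraFreq β M ks.1.1 ^ 2 + nambuXiCT L μ K ks.1.2 ^ 2) ≤ klScale klE0 n₀ := by
  by_cases h1 : klE5SoftLineSym L M β μ K n₀ κ Λ ks = 0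
  · rw [h1, zero_add] at h
    exact klRadius_le_of_klE5DressedSliceSym_ne_zero β μ K n₀ κ hΛ hΛn ks h
  · exact klRadius_le_of_klE5SoftLineSym_ne_zero (L := L) (M := M) (β := β) κ μ K n₀ hΛ hΛn ks h1

omit [NeZero L] in
/-- **The total symbol is soft-shaped with `A_p = 10`** under the dressing smallness at `Λ_{n₀+1}` and `Λ` (`8` for the soft line, `2` for the dressed slice). [folklore] -/
theorem norm_klE5TotalSym_le_div_radius (hβ : 0 ≤ β) {Λ : ℝ} (ks : FreqMomentum L M × Fin 2)
    (h1 : ‖klE5SliceSym L M β μ K n₀ (klScale klE0 (n₀ + 1)) ks * κ ks‖ ≤ 1 / 2) (hΛ : ‖klE5SliceSym L M β μ K n₀ Λ ks * κ ks‖ ≤ 1 / 2) :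
    ‖klE5SoftLineSym L M β μ K n₀ κ Λ ks + klE5SliceSym L M β μ K n₀ Λ ks / (1 + klE5SliceSym L M β μ K n₀ Λ ks * κ ks)‖ ≤
      10 * (β * (L : ℝ) ^ 2) / Real.sqrt (matsubaraFreq β M ks.1.1 ^ 2 + nambuXiCT L μ K ks.1.2 ^ 2) := by
  have ha := norm_klE5SoftLineSym_le_div_radius (L := L) (M := M) β μ K n₀ κ hβ ks h1 hΛ
  have hb := norm_klE5DressedSliceSym_le_div_radius (L := L) (M := M) β μ K n₀ κ hβ ks hΛ
  refine (norm_add_le _ _).trans ?_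
  have e : 10 * (β * (L : ℝ) ^ 2) / Real.sqrt (matsubaraFreq β M ks.1.1 ^ 2 + nambuXiCT L μ K ks.1.2 ^ 2) =
      8 * (β * (L : ℝ) ^ 2) / Real.sqrt (matsubaraFreq β M ks.1.1 ^ 2 + nambuXiCT L μ K ks.1.2 ^ 2) +
        2 * (β * (L : ℝ) ^ 2) / Real.sqrt (matsubaraFreq β M ks.1.1 ^ 2 + nambuXiCT L μ K ks.1.2 ^ 2) := by ring
  rw [e]
  exact add_le_add ha hb

end Symbols

/-! ## §6 Line data of a soft-shaped, plateau-supported symbol on the point-augmented fat family, under the stub binders -/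

section Package

/-- **Gram / entry / row data on the POINT-AUGMENTED fat family** (the `hGB`/`hrow`/`hcol` inputs of the carrier doors): there is an absolute `Cκ > 0`
(k3c2-p2's constant) such that under EXACTLY the binders of `gram_softShaped_bgmFat_sharp_klEng` (doors `klEngC₃3`, `klEngU₀4`, `klEngL₃`, `klEngM₃`;
`FrameOK`; fat level `1 ≤ m ≤ nScales β + 1`), for every symbol `p` with `‖p(ks)‖ ≤ A_p·βL²/ρ_K(ks)` and `ρ_K(ks) ≤ Λ_{m+1}` wherever `p(ks) ≠ 0`
(`0 ≤ A_p`) and every choice `e` of point momenta, on `F̃⁺ = pointAugmentFat (klAnisoFamily … m) (bgmFatMultiplier … m) e`: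
entries of `S(F̃⁺)ᵀ·normalCovariance p·S(F̃⁺)` are `≤ A_p·Cκ·e₀·8^{−m}`; both Gram half-norms are `≤ √(A_p·Cκ·e₀·8^{−m})` at EVERY label; the line is
`IsGramBoundedR` with that constant; and plain-fat row/column sums `≤ α` (`0 ≤ α`) transfer unchanged. [cite: BenfattoGiulianiMastropietro2006, §2.8 (2.80)] -/
theorem gram_softShaped_pointAugmentFat_klEng :
    ∃ Cκ : ℝ, 0 < Cκ ∧ ∀ (P : SplitConsts) (R : RenConsts) (c : ℝ), P.WF → R.WF2 → 0 < c → c ≤ klEngC₃3 P R →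
      ∀ μ ∈ klWindowC, ∀ U : ℝ, 0 < U → U ≤ klEngU₀4 P R c → ∀ β : ℝ, klBetaMin ≤ β → β ≤ Real.exp (c / U ^ 2) →
      ∀ K : TrigPolyC4v, FrameOK R U (nScales β) μ K → ∀ (L M : ℕ) [NeZero L] [NeZero M],
      klEngL₃ β U ≤ L → klEngM₃ β U L ≤ M → ∀ m : ℕ, 1 ≤ m → m ≤ nScales β + 1 →
      ∀ (p : FreqMomentum L M × Fin 2 → ℂ) (Ap : ℝ), 0 ≤ Ap →
      (∀ ks, p ks ≠ 0 → ‖p ks‖ ≤ Ap * (β * (L : ℝ) ^ 2) / Real.sqrt (matsubaraFreq β M ks.1.1 ^ 2 + nambuXiCT L μ K ks.1.2 ^ 2)) →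
      (∀ ks, p ks ≠ 0 → Real.sqrt (matsubaraFreq β M ks.1.1 ^ 2 + nambuXiCT L μ K ks.1.2 ^ 2) ≤ klScale klE0 (m + 1)) →
      ∀ {q₀ : ℕ} (e : Fin q₀ → FreqMomentum L M),
        (∀ Y Y' : SpaceTimeIdx L M × SectorLeg (sectorCount m + q₀),
          ‖((sectorSubMatrix L M β (pointAugmentFat (klAnisoFamily L M β μ K klE0 m) (bgmFatMultiplier L M klE0 β (nambuXiCT L μ K) m) e)).transpose *
              normalCovariance L M p *
              sectorSubMatrix L M β (pointAugmentFat (klAnisoFamily L M β μ K klE0 m) (bgmFatMultiplier L M klE0 β (nambuXiCT L μ K) m) e)) Y Y'‖ ≤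
            Ap * Cκ * (klE0 * ((8 : ℝ) ^ m)⁻¹)) ∧
        (∀ Y : SpaceTimeIdx L M × SectorLeg (sectorCount m + q₀),
          ‖sectorGramF L M β (pointAugmentFat (klAnisoFamily L M β μ K klE0 m) (bgmFatMultiplier L M klE0 β (nambuXiCT L μ K) m) e) p Y‖ ≤
            Real.sqrt (Ap * Cκ * (klE0 * ((8 : ℝ) ^ m)⁻¹))) ∧
        (∀ Y' : SpaceTimeIdx L M × SectorLeg (sectorCount m + q₀),
          ‖sectorGramG L M β (pointAugmentFat (klAnisoFamily L M β μ K klE0 m) (bgmFatMultiplier L M klE0 β (nambuXiCT L μ K) m) e) p Y'‖ ≤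
            Real.sqrt (Ap * Cκ * (klE0 * ((8 : ℝ) ^ m)⁻¹))) ∧
        IsGramBoundedR ((sectorSubMatrix L M β (pointAugmentFat (klAnisoFamily L M β μ K klE0 m) (bgmFatMultiplier L M klE0 β (nambuXiCT L μ K) m) e)).transpose *
              normalCovariance L M p *
              sectorSubMatrix L M β (pointAugmentFat (klAnisoFamily L M β μ K klE0 m) (bgmFatMultiplier L M klE0 β (nambuXiCT L μ K) m) e))
          (Real.sqrt (Ap * Cκ * (klE0 * ((8 : ℝ) ^ m)⁻¹))) ∧
        (∀ α : ℝ, 0 ≤ α →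
          (∀ X, ∑ Y, ‖((sectorSubMatrix L M β (bgmFatMultiplier L M klE0 β (nambuXiCT L μ K) m)).transpose * normalCovariance L M p *
              sectorSubMatrix L M β (bgmFatMultiplier L M klE0 β (nambuXiCT L μ K) m)) X Y‖ ≤ α) →
          (∀ Y, ∑ X, ‖((sectorSubMatrix L M β (bgmFatMultiplier L M klE0 β (nambuXiCT L μ K) m)).transpose * normalCovariance L M p *
              sectorSubMatrix L M β (bgmFatMultiplier L M klE0 β (nambuXiCT L μ K) m)) X Y‖ ≤ α) →
          (∀ X, ∑ Y, ‖((sectorSubMatrix L M β (pointAugmentFat (klAnisoFamily L M β μ K klE0 m) (bgmFatMultiplier L M klE0 β (nambuXiCT L μ K) m) e)).transpose *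
              normalCovariance L M p *
              sectorSubMatrix L M β (pointAugmentFat (klAnisoFamily L M β μ K klE0 m) (bgmFatMultiplier L M klE0 β (nambuXiCT L μ K) m) e)) X Y‖ ≤ α) ∧
          (∀ Y, ∑ X, ‖((sectorSubMatrix L M β (pointAugmentFat (klAnisoFamily L M β μ K klE0 m) (bgmFatMultiplier L M klE0 β (nambuXiCT L μ K) m) e)).transpose *
              normalCovariance L M p *
              sectorSubMatrix L M β (pointAugmentFat (klAnisoFamily L M β μ K klE0 m) (bgmFatMultiplier L M klE0 β (nambuXiCT L μ K) m) e)) X Y‖ ≤ α)) := by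
  obtain ⟨Cκ, hCκ, hGram⟩ := gram_softShaped_bgmFat_sharp_klEng
  refine ⟨Cκ, hCκ, ?_⟩
  intro P R c hP hR hc hc3 μ hμ U hU hU4 β hβ hβc K hF L M _ _ hL hM m hm hmN p Ap hAp hp hsupp q₀ e
  have he₀ : (0 : ℝ) < klE0 := by norm_num [klE0]
  obtain ⟨hent, -, hκF, hκG⟩ := hGram P R c hP hR hc hc3 μ hμ U hU hU4 β hβ hβc K hF L M hL hM m hm hmN p Ap hAp hp
  -- the symbol lives in the plateau of the thin family of level `m`
  have hpl : ∀ ks, p ks ≠ 0 → ∑ ω, klAnisoFamily L M β μ K klE0 m ω ks.1 = 1 :=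
    fun ks hks => sum_klAnisoFamily_eq_one_of_le β μ K he₀ m ks.1 (hsupp ks hks)
  have hC : ∀ X Y : HubbardFieldIdx L M, normalCovariance L M p X Y ≠ 0 →
      ∑ ω, klAnisoFamily L M β μ K klE0 m ω X.1.1 = 1 ∧ ∑ ω, klAnisoFamily L M β μ K klE0 m ω Y.1.1 = 1 :=
    fun X Y h => normalCovariance_plateau_of_symbol p (fun k => ∑ ω, klAnisoFamily L M β μ K klE0 m ω k) hpl X Y h
  have hκ0 : 0 ≤ Real.sqrt (Ap * Cκ * (klE0 * ((8 : ℝ) ^ m)⁻¹)) := Real.sqrt_nonneg _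
  have hF' : ∀ Y : SpaceTimeIdx L M × SectorLeg (sectorCount m + q₀),
      ‖sectorGramF L M β (pointAugmentFat (klAnisoFamily L M β μ K klE0 m) (bgmFatMultiplier L M klE0 β (nambuXiCT L μ K) m) e) p Y‖ ≤
        Real.sqrt (Ap * Cκ * (klE0 * ((8 : ℝ) ^ m)⁻¹)) :=
    fun Y => norm_sectorGramF_pointAugmentFat_le_of_forall β _ _ e p hpl hκ0 hκF Y
  have hG' : ∀ Y' : SpaceTimeIdx L M × SectorLeg (sectorCount m + q₀),
      ‖sectorGramG L M β (pointAugmentFat (klAnisoFamily L M β μ K klE0 m) (bgmFatMultiplier L M klE0 β (nambuXiCT L μ K) m) e) p Y'‖ ≤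
        Real.sqrt (Ap * Cκ * (klE0 * ((8 : ℝ) ^ m)⁻¹)) :=
    fun Y' => norm_sectorGramG_pointAugmentFat_le_of_forall β _ _ e p hpl hκ0 hκG Y'
  refine ⟨fun Y Y' => entry_pullback_pointAugmentFat_le β _ _ e _ hC (by positivity) hent Y Y', hF', hG',
    isGramBoundedR_of_halfNorm_le β _ p hκ0 hF' hG', fun α hα hrow hcol => ⟨?_, ?_⟩⟩
  · exact fun X => rowSum_pullback_pointAugmentFat_le β _ _ e _ hC hα hrow X
  · exact fun Y => colSum_pullback_pointAugmentFat_le β _ _ e _ hC hα hcol Y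

end Package

end Summit.HubbardSuperconductivity.HubbardSuperconductivity.Theorems.KLRegimeSplit

end
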